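import Summits.AtomisticToContinuum.Crystallization.Theorems.ChartedZeroExcessLayeredLatticeLiouvilleZZZYRCXRV
import Summits.AtomisticToContinuum.Crystallization.Theorems.ChartedZeroExcessLayeredLatticeLiouvilleZZZYRCXRW
import Summits.AtomisticToContinuum.Crystallization.Theorems.ChartedZeroExcessLayeredLatticeLiouvilleZZZYRCXRX

/-!
# ZZZYRCXRWD — THE UNIT ASSEMBLY UNDER LETTER SYMMETRY AND REVERSAL (hand-1's half-word units ⇒ the type contract)
(binder 26636, line (D); lens-2 g101; critic r1907 (B1) «total half-word decomposition», (B3) lemma (L3); consumer = hand-1 g56)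

Hand-1 certifies OUT-kernel UNITS: for a half-word `u₀` (a class representative) and a far layer `ym`, a block run on the upper half window
`[600 + H₀, 600 + 2H₀]`; ZZZYRCXRV `kernelSlabSoundOn_of_blocks` turns a group of them into the PART
`KernelSlabSoundOn H₀ R (AdmO u₀ (600+H₀) (600+2H₀) ∘ rhoOf) yms …`.  This file assembles the TYPE contract of a full window word `ω`
(`|ω| = 2H₀+1`, upper half-word `u`, lower half-word `v`) from TWO units of class representatives:
* the UP part of `ω` = the unit of `uU` with `uU = fU' ∘ u` letter-wise, transported along the letter symmetry (ZZZYRCXRW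
  `kernelSlabSoundAtP_sym_env`, affine realisation `(gU, σU, κU)`: `3·gU(fU' r) + r = σU·fU' r + κU` on letters) — envelope tables pinned by
  `ω`'s own letters (`pinW H₀ (gU ∘ fU') (wordZ ω)`);
* the DOWN part of `ω` = the unit of `uD` with `uD = fD' ∘ v.reverse`, transported along the symmetry AND the layer reversal (ZZZYRCXRX;
  §2 `kernelSlabSoundAtP_reverse`) — tables re-keyed by `revKey H₀`, pins `pinW H₀ (gD ∘ fD') (wordZ ω).reverse`;
joined on disjoint far layers (§4 `disjUD`, decided) and covering every layer within `M` of the centre (§4 `coverUD`, decided) into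
★★★ `kernelSlabSoundFE_of_units : … → KernelSlabSoundFE H₀ R (wordZ ω) lo hi P9max E (envU TRU + envD TRD ∘ revKey) (…)` (§5) — the
existential-data type contract the reader door of ZZZYRCXRWE consumes.  §3 is the letter bookkeeping (`AdmO` under `f'` and under reversal,
decided factor test `symWordChk`), §6 the six elements of S₃ in the door's coherence form (the transposition `A ↔ C`, `r ↦ 2 − r`, has
CONSTANT `g`: its envelope is exact), §7 toys at hand-1's literals (`H₀ = 5`, `M = 29`).  Imports ZZZYRCXRV, ZZZYRCXRW, ZZZYRCXRX; 0 sorry. [g101]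
-/

namespace Summit.AtomisticToContinuum.Crystallization.Theorems.ChartedZeroExcessLayeredLatticeLiouville.ThetaKernel

/-! ### §1 the part contract IS the per-sequence contract on the block layers -/

/-- ZZZYRCXRV's part on the far layers `yms` under `Agree` = ZZZYRCXRWA's per-sequence contract for every agreeing letter sequence, with
`Far m := ∃ ym ∈ yms, m = ym − 600` (definitional). [g101] -/
theorem kernelSlabSoundOn_iff {H₀ R E : ℕ} {A : (ℤ → ℤ) → Prop} {yms : List ℕ} {lo hi P9max : ℤ} {cd : List ChordDatum}
    {TRz TNz : ℤ × ℤ × ℤ × ℤ → ℤ} :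
    KernelSlabSoundOn H₀ R A yms lo hi P9max E cd TRz TNz ↔ ∀ ℓ : ℤ → ℤ, IsLetterSeq ℓ → A ℓ →
      KernelSlabSoundAtP H₀ R ℓ (fun m => ∃ ym ∈ yms, m = (ym : ℤ) - 600) lo hi P9max E cd TRz TNz :=
  Iff.rfl

/-! ### §2 reversal at one sequence -/

/-- ★ REVERSAL, PER SEQUENCE (pull-back form): data sound at the reflected sequence `revLetters (2H₀) ℓ` on `Far` ⇒ the reflected data are
sound at `ℓ` on the reflected far layers, tables re-keyed by `revKey H₀` (ZZZYRCXRX §1–§4; site maps of ZZZYRCZS §2). [g101] -/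
theorem kernelSlabSoundAtP_reverse {H₀ R E : ℕ} {ℓ : ℤ → ℤ} {Far : ℤ → Prop} {lo hi P9max : ℤ} {cd : List ChordDatum}
    {TRz TNz : ℤ × ℤ × ℤ × ℤ → ℤ} (h : KernelSlabSoundAtP H₀ R (revLetters (2 * (H₀ : ℤ)) ℓ) Far lo hi P9max E cd TRz TNz) :
    KernelSlabSoundAtP H₀ R ℓ (fun m => Far (2 * (H₀ : ℤ) - m)) lo hi P9max E (cd.map (revChord H₀)) (fun k => TRz (revKey H₀ k))
      fun k => TNz (revKey H₀ k) := by
  obtain ⟨hV, hnd, hcomp, hT⟩ := h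
  refine ⟨?_, ?_, ?_, fun k => ?_⟩
  · intro c' hc'
    obtain ⟨c, hc, rfl⟩ := List.mem_map.1 hc'
    obtain ⟨hcb, hfar, hpw, hpc⟩ := hV c hc
    refine ⟨isCenterBased_rev hcb, ?_, piecesWithin_rev hpw, fun hlo hhi i hi => ?_⟩
    · show Far (2 * (H₀ : ℤ) - (2 * (H₀ : ℤ) - c.1.2.2))
      rwa [sub_sub_cancel]
    · rw [revChord_fst, n9F_revPair] at hlo hhi
      rw [chordNp_rev] at hi
      rw [chordPiece_rev, n9F_revPair]
      exact hpc hlo hhi i hi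
  · rw [map_fst_revChord]
    exact hnd.map (revPair_injective (2 * (H₀ : ℤ)))
  · intro x hx hfar hlo hhi
    rw [← revPair_revPair (2 * (H₀ : ℤ)) x, n9F_revPair] at hlo hhi
    obtain ⟨c, hc, hc1⟩ := hcomp (revPair (2 * (H₀ : ℤ)) x) (isCenterBased_rev hx) hfar hlo hhi
    exact ⟨revChord H₀ c, List.mem_map.2 ⟨c, hc, rfl⟩, by rw [revChord_fst, hc1, revPair_revPair]⟩
  · rw [thetaR0G_rev, thetaN0G_rev]
    exact hT (revKey H₀ k)

/-! ### §3 letter bookkeeping: admissibility under a letter map and under reversal -/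

/-- DECIDED: `u₀` is the letter-wise image of `u` under `f'` (same length). -/
def symWordChk (f' : ℤ → ℤ) (u u₀ : List ℕ) : Bool :=
  decide (u₀.length = u.length) && (List.range u.length).all fun i => decide (((u₀.getD i 0 : ℕ) : ℤ) = f' (u.getD i 0))

/-- soundness of `symWordChk`. [folklore] -/
theorem getD_of_symWordChk {f' : ℤ → ℤ} {u u₀ : List ℕ} (h : symWordChk f' u u₀ = true) {i : ℕ} (hi : i < u.length) :
    ((u₀.getD i 0 : ℕ) : ℤ) = f' (u.getD i 0) := by
  unfold symWordChk at h
  rw [Bool.and_eq_true] at h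
  simpa using List.all_eq_true.mp h.2 i (List.mem_range.mpr hi)

/-- ★ admissible for `u` on `[wlo, whi]` ⇒ the letter-wise mapped sequence `f' ∘ ℓ''` is admissible for the image word `u₀` (the window covered
by the word: `whi + 1 ≤ wlo + |u|`). [g101] -/
theorem admO_symW {ℓ'' f' : ℤ → ℤ} (hℓ'' : IsLetterSeq ℓ'') (hf' : ∀ r : ℤ, 0 ≤ r → r ≤ 2 → 0 ≤ f' r ∧ f' r ≤ 2) {u u₀ : List ℕ}
    {wlo whi : ℕ} (hchk : symWordChk f' u u₀ = true) (hcov : whi + 1 ≤ wlo + u.length) (h : AdmO u wlo whi (rhoOf ℓ'')) :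
    AdmO u₀ wlo whi (rhoOf fun m => f' (ℓ'' m)) := by
  have hℓ : IsLetterSeq (fun m => f' (ℓ'' m)) := fun m => hf' _ (hℓ'' m).1 (hℓ'' m).2
  refine ⟨fun am ham => ?_, rhoOf_le_two hℓ⟩
  have ham' := ham
  unfold inWin at ham'
  rw [Bool.and_eq_true, Nat.ble_eq, Nat.ble_eq] at ham'
  have h1 := h.1 am ham
  have hc1 := rhoOf_cast hℓ'' am
  have hc2 := rhoOf_cast hℓ am
  have hs := getD_of_symWordChk hchk (i := am - wlo) (by omega)
  have key : ((rhoOf (fun m => f' (ℓ'' m)) am : ℕ) : ℤ) = ((u₀.getD (am - wlo) 0 : ℕ) : ℤ) := by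
    rw [hc2, hs, ← h1, hc1]
  exact_mod_cast key

/-- ★ admissible for the lower half-word `v` (`|v| = H₀+1`) on `[600, 600+H₀]` ⇒ the reflected sequence is admissible for `v.reverse` on the
upper half window `[600+H₀, 600+2H₀]`. [g101] -/
theorem admO_rev {ℓ'' : ℤ → ℤ} (hℓ'' : IsLetterSeq ℓ'') {H₀ : ℕ} {v : List ℕ} (hvl : v.length = H₀ + 1)
    (h : AdmO v 600 (600 + H₀) (rhoOf ℓ'')) : AdmO v.reverse (600 + H₀) (600 + 2 * H₀) (rhoOf (revLetters (2 * (H₀ : ℤ)) ℓ'')) := by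
  refine ⟨fun am ham => ?_, rhoOf_le_two (isLetterSeq_revLetters (2 * (H₀ : ℤ)) hℓ'')⟩
  have ham' := ham
  unfold inWin at ham'
  rw [Bool.and_eq_true, Nat.ble_eq, Nat.ble_eq] at ham'
  have hin : inWin 600 (600 + H₀) (1200 + 2 * H₀ - am) = true := by
    unfold inWin; rw [Bool.and_eq_true, Nat.ble_eq, Nat.ble_eq]; omega
  have h1 := h.1 _ hin
  rw [show 1200 + 2 * H₀ - am - 600 = 600 + 2 * H₀ - am by omega] at h1
  have hc1 := rhoOf_cast hℓ'' (1200 + 2 * H₀ - am)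
  have hc2 : ((rhoOf (revLetters (2 * (H₀ : ℤ)) ℓ'') am : ℕ) : ℤ) = ℓ'' (2 * (H₀ : ℤ) - ((am : ℤ) - 600)) :=
    rhoOf_cast (isLetterSeq_revLetters (2 * (H₀ : ℤ)) hℓ'') am
  have ht : (((1200 + 2 * H₀ - am : ℕ) : ℤ) - 600) = 2 * (H₀ : ℤ) - ((am : ℤ) - 600) := by
    rw [Nat.cast_sub (by omega)]; push_cast; ring
  have hi3 : v.length - 1 - (am - (600 + H₀)) = 600 + 2 * H₀ - am := by omega
  have hidx : v.reverse.getD (am - (600 + H₀)) 0 = v.getD (600 + 2 * H₀ - am) 0 := by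
    rw [List.getD_eq_getElem _ _ (by rw [List.length_reverse]; omega), List.getElem_reverse,
      List.getD_eq_getElem _ _ (by omega)]
    simp only [hi3]
  have key : ((rhoOf (revLetters (2 * (H₀ : ℤ)) ℓ'') am : ℕ) : ℤ) = ((v.reverse.getD (am - (600 + H₀)) 0 : ℕ) : ℤ) := by
    rw [hc2, hidx, ← h1, hc1, ht]
  exact_mod_cast key

/-! ### §4 decided far-layer bookkeeping of an UP/DOWN pair of parts -/

/-- DECIDED: the UP far layers `ymsU` (far layer `ym − 600`) and the reflected DOWN far layers `ymsD` (far layer `2H₀ − (ym − 600)`) are disjoint. -/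
def disjUD (H₀ : ℕ) (ymsU ymsD : List ℕ) : Bool := ymsU.all fun ym => ymsD.all fun ym' => !decide (ym + ym' = 1200 + 2 * H₀)

/-- DECIDED: every layer within `M` of the centre is an UP far layer or a reflected DOWN far layer. -/
def coverUD (H₀ M : ℕ) (ymsU ymsD : List ℕ) : Bool :=
  (List.range (2 * M + 1)).all fun i => ymsU.elem (600 + H₀ + i - M) || ymsD.elem (600 + H₀ + M - i)

/-- soundness of `disjUD`. [folklore] -/
theorem disj_of_disjUD {H₀ : ℕ} {ymsU ymsD : List ℕ} (h : disjUD H₀ ymsU ymsD = true) (m : ℤ) :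
    (∃ ym ∈ ymsU, m = (ym : ℤ) - 600) → ¬∃ ym ∈ ymsD, 2 * (H₀ : ℤ) - m = (ym : ℤ) - 600 := by
  rintro ⟨ym, hym, rfl⟩ ⟨ym', hym', e⟩
  unfold disjUD at h
  have h1 := List.all_eq_true.mp (List.all_eq_true.mp h ym hym) ym' hym'
  simp only [Bool.not_eq_true', decide_eq_false_iff_not] at h1
  omega

/-- soundness of `coverUD`. [folklore] -/
theorem far_of_coverUD {H₀ M : ℕ} {ymsU ymsD : List ℕ} (h : coverUD H₀ M ymsU ymsD = true) (hM : M ≤ 600 + H₀) (m : ℤ)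
    (hm : |m - H₀| ≤ M) : (∃ ym ∈ ymsU, m = (ym : ℤ) - 600) ∨ ∃ ym ∈ ymsD, 2 * (H₀ : ℤ) - m = (ym : ℤ) - 600 := by
  rw [abs_le] at hm
  unfold coverUD at h
  have hi := List.all_eq_true.mp h (m - H₀ + M).toNat (List.mem_range.mpr (by omega))
  rw [Bool.or_eq_true] at hi
  rcases hi with hi | hi
  · exact Or.inl ⟨_, List.elem_iff.mp hi, by omega⟩
  · exact Or.inr ⟨_, List.elem_iff.mp hi, by omega⟩

/-! ### §5 ★★★ the assembly door -/

/-- ★★★ **THE TYPE CONTRACT FROM TWO UNITS OF CLASS REPRESENTATIVES.**  `ω` a window word (`|ω| = 2H₀+1`) with upper half-word `u` (factor at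
`H₀`) and lower half-word `v` (factor at `0`), `|u| = |v| = H₀+1`; an UP unit of `uU = fU' ∘ u` and an UP unit of `uD = fD' ∘ v.reverse`, each with
an affine realisation of its letter map (`σ² = 1`, `3·g(f' r) + r = σ·f' r + κ`, `g (f' r) ∈ {g₀, g₁}`, `f'` letters to letters — §6); far layers
disjoint and covering radius `M` (`hi < 6(M+1)²`, decided §4).  Conclusion: `KernelSlabSoundFE` of `wordZ ω` with the UP envelope tables plus
the DOWN envelope tables re-keyed by `revKey H₀`.  The identity (`f' = id`, `g = 0`, `σ = 1`, `κ = 0`) is the untransported case. [g101] -/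
theorem kernelSlabSoundFE_of_units {ω u v uU uD : List ℕ} {H₀ R E M : ℕ} {lo hi P9max : ℤ} {ymsU ymsD : List ℕ}
    {cdU cdD : List ChordDatum} {TRU TNU TRD TND : ℤ × ℤ × ℤ × ℤ → ℤ} {fU' gU fD' gD : ℤ → ℤ} {σU κU gU₀ gU₁ σD κD gD₀ gD₁ : ℤ}
    (hwl : ω.length = 2 * H₀ + 1) (hu : subWord ω H₀ u = true) (hul : u.length = H₀ + 1) (hv : subWord ω 0 v = true)
    (hvl : v.length = H₀ + 1)
    (hU : KernelSlabSoundOn H₀ R (fun ℓ => AdmO uU (600 + H₀) (600 + 2 * H₀) (rhoOf ℓ)) ymsU lo hi P9max E cdU TRU TNU)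
    (hσU : σU * σU = 1) (hcohU : ∀ r : ℤ, 0 ≤ r → r ≤ 2 → 3 * gU (fU' r) + r = σU * fU' r + κU)
    (hgU : ∀ r : ℤ, 0 ≤ r → r ≤ 2 → gU (fU' r) = gU₀ ∨ gU (fU' r) = gU₁) (hfU' : ∀ r : ℤ, 0 ≤ r → r ≤ 2 → 0 ≤ fU' r ∧ fU' r ≤ 2)
    (hchkU : symWordChk fU' u uU = true)
    (hD : KernelSlabSoundOn H₀ R (fun ℓ => AdmO uD (600 + H₀) (600 + 2 * H₀) (rhoOf ℓ)) ymsD lo hi P9max E cdD TRD TND)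
    (hσD : σD * σD = 1) (hcohD : ∀ r : ℤ, 0 ≤ r → r ≤ 2 → 3 * gD (fD' r) + r = σD * fD' r + κD)
    (hgD : ∀ r : ℤ, 0 ≤ r → r ≤ 2 → gD (fD' r) = gD₀ ∨ gD (fD' r) = gD₁) (hfD' : ∀ r : ℤ, 0 ≤ r → r ≤ 2 → 0 ≤ fD' r ∧ fD' r ≤ 2)
    (hchkD : symWordChk fD' v.reverse uD = true)
    (hdisj : disjUD H₀ ymsU ymsD = true) (hcov : coverUD H₀ M ymsU ymsD = true) (hM : M ≤ 600 + H₀) (hMb : hi < 6 * ((M : ℤ) + 1) ^ 2) :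
    KernelSlabSoundFE H₀ R (wordZ ω) lo hi P9max E
      (fun k => envTab σU (pinW H₀ (fun r => gU (fU' r)) (wordZ ω)) gU₀ gU₁ TRU k +
        envTab σD (pinW H₀ (fun r => gD (fD' r)) (wordZ ω).reverse) gD₀ gD₁ TRD (revKey H₀ k))
      fun k => envTab σU (pinW H₀ (fun r => gU (fU' r)) (wordZ ω)) gU₀ gU₁ TNU k +
        envTab σD (pinW H₀ (fun r => gD (fD' r)) (wordZ ω).reverse) gD₀ gD₁ TND (revKey H₀ k) := by
  have hwlZ : (wordZ ω).length = 2 * H₀ + 1 := by rw [length_wordZ, hwl]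
  refine kernelSlabSoundFE_of_parts hMb fun ℓ'' hℓ'' hag => ?_
  -- UP: the unit of `uU` at the sequence `fU' ∘ ℓ''`, transported to `ℓ''`
  have hℓU : IsLetterSeq (fun m => fU' (ℓ'' m)) := fun m => hfU' _ (hℓ'' m).1 (hℓ'' m).2
  have haU : AdmO uU (600 + H₀) (600 + 2 * H₀) (rhoOf fun m => fU' (ℓ'' m)) :=
    admO_symW hℓ'' hfU' hchkU (by omega) (admO_rhoOf_sub hℓ'' hwl hag hu (by omega) le_rfl)
  have hPU := kernelSlabSoundOn_iff.mp hU _ hℓU haU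
  have hpinU : ∀ m w, pinW H₀ (fun r => gU (fU' r)) (wordZ ω) m = some w → gU (fU' (ℓ'' m)) = w := by
    intro m w hm
    unfold pinW at hm
    split_ifs at hm with hc
    · rw [hag m hc.1 hc.2]
      exact Option.some.inj hm
  have hTU := kernelSlabSoundAtP_sym_env (ℓ' := ℓ'') hσU (fun m => hcohU _ (hℓ'' m).1 (hℓ'' m).2) hpinU
    (fun m => hgU _ (hℓ'' m).1 (hℓ'' m).2) hPU
  -- DOWN: the unit of `uD` at the sequence `fD' ∘ revLetters (2H₀) ℓ''`, transported to `revLetters (2H₀) ℓ''`, then reflected to `ℓ''`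
  have hagR : AgreesOnWindow H₀ (wordZ ω).reverse (revLetters (2 * (H₀ : ℤ)) ℓ'') :=
    agreesOnWindow_rev (by rw [List.length_reverse, hwlZ]) (by rw [List.reverse_reverse]; exact hag)
  have hℓR : IsLetterSeq (revLetters (2 * (H₀ : ℤ)) ℓ'') := isLetterSeq_revLetters (2 * (H₀ : ℤ)) hℓ''
  have hℓD : IsLetterSeq (fun m => fD' (revLetters (2 * (H₀ : ℤ)) ℓ'' m)) := fun m => hfD' _ (hℓR m).1 (hℓR m).2
  have haD : AdmO uD (600 + H₀) (600 + 2 * H₀) (rhoOf fun m => fD' (revLetters (2 * (H₀ : ℤ)) ℓ'' m)) :=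
    admO_symW hℓR hfD' hchkD (by rw [List.length_reverse]; omega)
      (admO_rev hℓ'' hvl (admO_rhoOf_sub hℓ'' hwl hag hv (by omega) (by omega)))
  have hPD := kernelSlabSoundOn_iff.mp hD _ hℓD haD
  have hpinD : ∀ m w, pinW H₀ (fun r => gD (fD' r)) (wordZ ω).reverse m = some w → gD (fD' (revLetters (2 * (H₀ : ℤ)) ℓ'' m)) = w := by
    intro m w hm
    unfold pinW at hm
    split_ifs at hm with hc
    · rw [hagR m hc.1 hc.2]
      exact Option.some.inj hm
  have hTD := kernelSlabSoundAtP_reverse (kernelSlabSoundAtP_sym_env (ℓ' := revLetters (2 * (H₀ : ℤ)) ℓ'') hσD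
    (fun m => hcohD _ (hℓR m).1 (hℓR m).2) hpinD (fun m => hgD _ (hℓR m).1 (hℓR m).2) hPD)
  exact ⟨_, _, fun m hm => far_of_coverUD hcov hM m hm, kernelSlabSoundAtP_append hTU hTD (disj_of_disjUD hdisj)⟩

/-! ### §6 the six elements of S₃ in the door's form `(f', g, σ, κ, g₀, g₁)` -/

/-- identity: `f' = id`, `g = 0`, `σ = 1`, `κ = 0`. [g101] -/
theorem symU_id : (∀ r : ℤ, 0 ≤ r → r ≤ 2 → 3 * (fun _ : ℤ => (0 : ℤ)) ((fun r : ℤ => r) r) + r = 1 * (fun r : ℤ => r) r + 0) ∧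
    (∀ r : ℤ, 0 ≤ r → r ≤ 2 → (fun _ : ℤ => (0 : ℤ)) ((fun r : ℤ => r) r) = 0 ∨ (fun _ : ℤ => (0 : ℤ)) ((fun r : ℤ => r) r) = 0) ∧
    ∀ r : ℤ, 0 ≤ r → r ≤ 2 → 0 ≤ (fun r : ℤ => r) r ∧ (fun r : ℤ => r) r ≤ 2 :=
  ⟨fun r _ _ => by ring, fun r _ _ => Or.inl rfl, fun r h0 h2 => ⟨h0, h2⟩⟩

/-- type letters = rep letters rotated `+1`: `f' r = (r+2) % 3`, `g = [· = 2]`, `σ = 1`, `κ = 1`, `g ∘ f' ∈ {0, 1}`. [g101] -/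
theorem symU_rot : (∀ r : ℤ, 0 ≤ r → r ≤ 2 →
      3 * (fun s : ℤ => if s = 2 then (1 : ℤ) else 0) ((fun r : ℤ => (r + 2) % 3) r) + r = 1 * (fun r : ℤ => (r + 2) % 3) r + 1) ∧
    (∀ r : ℤ, 0 ≤ r → r ≤ 2 → (fun s : ℤ => if s = 2 then (1 : ℤ) else 0) ((fun r : ℤ => (r + 2) % 3) r) = 0 ∨
      (fun s : ℤ => if s = 2 then (1 : ℤ) else 0) ((fun r : ℤ => (r + 2) % 3) r) = 1) ∧
    ∀ r : ℤ, 0 ≤ r → r ≤ 2 → 0 ≤ (fun r : ℤ => (r + 2) % 3) r ∧ (fun r : ℤ => (r + 2) % 3) r ≤ 2 := by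
  refine ⟨fun r h0 h2 => ?_, fun r h0 h2 => ?_, fun r h0 h2 => ?_⟩ <;> interval_cases r <;> decide

/-- type letters = rep letters rotated `−1`: `f' r = (r+1) % 3`, `g = −[· = 0]`, `σ = 1`, `κ = −1`, `g ∘ f' ∈ {−1, 0}`. [g101] -/
theorem symU_rot' : (∀ r : ℤ, 0 ≤ r → r ≤ 2 →
      3 * (fun s : ℤ => if s = 0 then (-1 : ℤ) else 0) ((fun r : ℤ => (r + 1) % 3) r) + r = 1 * (fun r : ℤ => (r + 1) % 3) r + -1) ∧
    (∀ r : ℤ, 0 ≤ r → r ≤ 2 → (fun s : ℤ => if s = 0 then (-1 : ℤ) else 0) ((fun r : ℤ => (r + 1) % 3) r) = -1 ∨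
      (fun s : ℤ => if s = 0 then (-1 : ℤ) else 0) ((fun r : ℤ => (r + 1) % 3) r) = 0) ∧
    ∀ r : ℤ, 0 ≤ r → r ≤ 2 → 0 ≤ (fun r : ℤ => (r + 1) % 3) r ∧ (fun r : ℤ => (r + 1) % 3) r ≤ 2 := by
  refine ⟨fun r h0 h2 => ?_, fun r h0 h2 => ?_, fun r h0 h2 => ?_⟩ <;> interval_cases r <;> decide

/-- transposition `B ↔ C`: `f' r = (3 − r) % 3`, `g = −[· ≠ 0]`, `σ = −1`, `κ = 0`, `g ∘ f' ∈ {0, −1}`. [g101] -/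
theorem symU_swapBC : (∀ r : ℤ, 0 ≤ r → r ≤ 2 →
      3 * (fun s : ℤ => if s = 0 then (0 : ℤ) else -1) ((fun r : ℤ => (3 - r) % 3) r) + r = -1 * (fun r : ℤ => (3 - r) % 3) r + 0) ∧
    (∀ r : ℤ, 0 ≤ r → r ≤ 2 → (fun s : ℤ => if s = 0 then (0 : ℤ) else -1) ((fun r : ℤ => (3 - r) % 3) r) = 0 ∨
      (fun s : ℤ => if s = 0 then (0 : ℤ) else -1) ((fun r : ℤ => (3 - r) % 3) r) = -1) ∧
    ∀ r : ℤ, 0 ≤ r → r ≤ 2 → 0 ≤ (fun r : ℤ => (3 - r) % 3) r ∧ (fun r : ℤ => (3 - r) % 3) r ≤ 2 := by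
  refine ⟨fun r h0 h2 => ?_, fun r h0 h2 => ?_, fun r h0 h2 => ?_⟩ <;> interval_cases r <;> decide

/-- transposition `A ↔ B`: `f' r = (4 − r) % 3`, `g = −[· = 2]`, `σ = −1`, `κ = 1`, `g ∘ f' ∈ {0, −1}`. [g101] -/
theorem symU_swapAB : (∀ r : ℤ, 0 ≤ r → r ≤ 2 →
      3 * (fun s : ℤ => if s = 2 then (-1 : ℤ) else 0) ((fun r : ℤ => (4 - r) % 3) r) + r = -1 * (fun r : ℤ => (4 - r) % 3) r + 1) ∧
    (∀ r : ℤ, 0 ≤ r → r ≤ 2 → (fun s : ℤ => if s = 2 then (-1 : ℤ) else 0) ((fun r : ℤ => (4 - r) % 3) r) = 0 ∨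
      (fun s : ℤ => if s = 2 then (-1 : ℤ) else 0) ((fun r : ℤ => (4 - r) % 3) r) = -1) ∧
    ∀ r : ℤ, 0 ≤ r → r ≤ 2 → 0 ≤ (fun r : ℤ => (4 - r) % 3) r ∧ (fun r : ℤ => (4 - r) % 3) r ≤ 2 := by
  refine ⟨fun r h0 h2 => ?_, fun r h0 h2 => ?_, fun r h0 h2 => ?_⟩ <;> interval_cases r <;> decide

/-- transposition `A ↔ C`: `f' r = 2 − r` is AFFINE on the letters themselves — `g = 0`, `σ = −1`, `κ = 2`: NO cell shift, the envelope of
§5 is exact for this element. [g101] -/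
theorem symU_swapAC : (∀ r : ℤ, 0 ≤ r → r ≤ 2 → 3 * (fun _ : ℤ => (0 : ℤ)) ((fun r : ℤ => 2 - r) r) + r = -1 * (fun r : ℤ => 2 - r) r + 2) ∧
    (∀ r : ℤ, 0 ≤ r → r ≤ 2 → (fun _ : ℤ => (0 : ℤ)) ((fun r : ℤ => 2 - r) r) = 0 ∨ (fun _ : ℤ => (0 : ℤ)) ((fun r : ℤ => 2 - r) r) = 0) ∧
    ∀ r : ℤ, 0 ≤ r → r ≤ 2 → 0 ≤ (fun r : ℤ => 2 - r) r ∧ (fun r : ℤ => 2 - r) r ≤ 2 :=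
  ⟨fun r _ _ => by ring, fun r _ _ => Or.inl rfl, fun r h0 h2 => ⟨by simp only; omega, by simp only; omega⟩⟩

/-! ### §7 toys at hand-1's literals -/

/-- toy (`H₀ = 5`, `M = 29`): UP units on the shifted far layers `605 … 634` and DOWN-by-reversal units on `606 … 634` are disjoint and cover
radius `29`; the rotated image of the half-word `120120` is `012012`. [g101] -/
example : disjUD 5 (List.range' 605 30) (List.range' 606 29) = true ∧ coverUD 5 29 (List.range' 605 30) (List.range' 606 29) = true ∧
    symWordChk (fun r : ℤ => (r + 2) % 3) [1, 2, 0, 1, 2, 0] [0, 1, 2, 0, 1, 2] = true := by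
  refine ⟨by decide, by decide, by decide⟩

end Summit.AtomisticToContinuum.Crystallization.Theorems.ChartedZeroExcessLayeredLatticeLiouville.ThetaKernel
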